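import Mathlib
import Summits.KontsevichZagierPeriods.KontsevichZagierPeriods.Theorems.InverseLandauTateLiftingDimZeroLift
import Summits.KontsevichZagierPeriods.KontsevichZagierPeriods.Theorems.InverseLandauTateFamilyKernelCurvesStubAnglePartToArcs

/-!
# `TateLifting` (stmt-KontsevichZagierPeriods-9129), line `Sketch` — stub `stub_dimZeroSector`

THE DIMENSION-ZERO SECTOR, unconditionally and Baker-free. Every vanishing `ℤ`-combination
`Σᵢ mᵢ [rᵢ]` of integral representations `rᵢ` of dimension `0` is a relation of the
Kontsevich–Zagier calculus.

The space `ℝ⁰ = (Fin 0 → ℝ)` is one point `pt`, so each `rᵢ.domain` is either empty or the whole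
space.

* Empty domain: `[rᵢ]` is a relation (null domain, `DimOne.dz_of_mem_relations_of_not_mem`); we
  replace `rᵢ` by the zero representation `z = [pt, 0]`, itself a relation
  (`KZ.of_mem_relations_of_eqOn_zero`), without changing the class of the combination modulo
  relations.
* Full domains: the value of `rᵢ` is the number `rᵢ.integrand pt` (Lebesgue measure on `ℝ⁰` is the
  Dirac mass, `Measure.pi_of_empty`), so by soundness of the calculus
  (`KZ.relations_le_ker_eval_holds`) the hypothesis reads `Σᵢ mᵢ · rᵢ.integrand pt = 0`, i.e. the
  integrand of `z` is the integer-weighted sum of the integrands of the `rᵢ` on the common domain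
  `ℝ⁰`; integer-weighted integrand additivity (rule 1b, `ap_of_sub_sum_zsmul_mem`) gives
  `[z] − Σᵢ mᵢ [rᵢ] ∈ relations`, and `[z]` is a relation.

References: M. Kontsevich, D. Zagier, *Periods* (2001), §1.2, rule (1).
-/

noncomputable section

open MeasureTheory Set MvPolynomial
open Literature.ModelTheory.ExponentialFields (IsSemialgebraic isSemialgebraic_univ)
open Literature.NumberTheory.Transcendental

namespace Summit.KontsevichZagierPeriods.InverseLandau

namespace DimOne

/-! ### Dimension-zero sector helpers (`dzs_`) -/

/-- A subset of the point `ℝ⁰` containing the point is the whole space. [folklore] -/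
theorem dzs_domain_eq_univ (r : KZ.IntegralRep 0) (h : (default : Fin 0 → ℝ) ∈ r.domain) :
    r.domain = univ :=
  Set.eq_univ_of_forall fun x => (Subsingleton.elim default x) ▸ h

/-- **Value over the point.** The value of a representation of dimension `0` with full domain is
its integrand at the point of `ℝ⁰` (Lebesgue measure on `ℝ⁰` is the Dirac mass, `vol ℝ⁰ = 1`).
[cite: KontsevichZagier2001, §1.1] -/
theorem dzs_value_eq_integrand (r : KZ.IntegralRep 0) (hd : r.domain = univ) :
    r.value = r.integrand default := by
  unfold KZ.IntegralRep.value
  rw [hd, Measure.restrict_univ, volume_pi, Measure.pi_of_empty _ default, integral_dirac]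

/-- **Evaluation over the point.** For representations of dimension `0` with full domains,
`eval (Σᵢ mᵢ [rᵢ]) = Σᵢ mᵢ · rᵢ.integrand pt`. [cite: KontsevichZagier2001, §1.2] -/
theorem dzs_eval_sum_zsmul {s : ℕ} (m : Fin s → ℤ) (r : Fin s → KZ.IntegralRep 0)
    (hd : ∀ i, (r i).domain = univ) :
    KZ.eval (∑ i, m i • KZ.of (r i)) = ∑ i, (m i : ℝ) * (r i).integrand default := by
  rw [map_sum]
  refine Finset.sum_congr rfl fun i _ => ?_
  rw [map_zsmul, KZ.eval_of, dzs_value_eq_integrand (r i) (hd i), zsmul_eq_mul]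

/-- **Full domains.** A vanishing `ℤ`-combination of representations of dimension `0` with FULL
domains is a relation: its evaluation is `Σᵢ mᵢ · rᵢ.integrand pt = 0`, so the zero representation
`z = [pt, 0]` has integrand `Σᵢ mᵢ · rᵢ.integrand` on the common domain and integer-weighted
integrand additivity (rule 1b) gives `[z] − Σᵢ mᵢ [rᵢ] ∈ relations`, with `[z]` a relation.
[cite: KontsevichZagier2001, §1.2] -/
theorem dzs_sum_zsmul_mem_of_domain_eq_univ {s : ℕ} (m : Fin s → ℤ) (r : Fin s → KZ.IntegralRep 0)
    (hd : ∀ i, (r i).domain = univ) (hev : KZ.eval (∑ i, m i • KZ.of (r i)) = 0) :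
    ∑ i, m i • KZ.of (r i) ∈ KZ.relations := by
  obtain ⟨z, hzd, hzi⟩ := KZ.exists_zeroRep (n := 0) (σ := univ) isSemialgebraic_univ
  have hz : KZ.of z ∈ KZ.relations :=
    KZ.of_mem_relations_of_eqOn_zero z (by rw [hzi]; exact fun _ _ => rfl)
  have hsum : ∑ i, (m i : ℝ) * (r i).integrand default = 0 := by
    rw [← dzs_eval_sum_zsmul m r hd, hev]
  have hap : KZ.of z - ∑ i, m i • KZ.of (r i) ∈ KZ.relations :=
    ap_of_sub_sum_zsmul_mem z r m (fun i => by rw [hd i, hzd]) fun x _ => by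
      change z.integrand x = ∑ i, (m i : ℝ) * (r i).integrand x
      rw [Subsingleton.elim x default, hzi, Pi.zero_apply, hsum]
  have e : ∑ i, m i • KZ.of (r i) = KZ.of z - (KZ.of z - ∑ i, m i • KZ.of (r i)) := by abel
  rw [e]
  exact KZ.relations.sub_mem hz hap

/-- **Discarding empty domains.** Replacing, in a `ℤ`-combination of representations of dimension
`0`, every representation whose domain misses the point by a fixed relation `z` does not change the
class modulo relations (each discarded `[rᵢ]` is itself a relation, null domain).
[cite: KontsevichZagier2001, §1.2] -/
theorem dzs_sum_sub_sum_ite_mem {s : ℕ} (m : Fin s → ℤ) (r : Fin s → KZ.IntegralRep 0)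
    (z : KZ.IntegralRep 0) (hz : KZ.of z ∈ KZ.relations)
    [∀ i, Decidable ((default : Fin 0 → ℝ) ∈ (r i).domain)] :
    ∑ i, m i • KZ.of (r i) -
        ∑ i, m i • KZ.of (if (default : Fin 0 → ℝ) ∈ (r i).domain then r i else z) ∈
      KZ.relations := by
  rw [← Finset.sum_sub_distrib]
  refine sum_mem fun i _ => ?_
  rw [← zsmul_sub]
  refine KZ.relations.zsmul_mem ?_ _
  by_cases h : (default : Fin 0 → ℝ) ∈ (r i).domain
  · rw [if_pos h, sub_self]
    exact KZ.relations.zero_mem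
  · rw [if_neg h]
    exact KZ.relations.sub_mem (dz_of_mem_relations_of_not_mem (r i) h) hz

end DimOne

/-- **Dimension-zero sector** (stub `stub_dimZeroSector` of the lead's skeleton, the body of
`DimZeroSector`), unconditional and Baker-free: every vanishing `ℤ`-combination of integral
representations over `ℝ⁰` is a relation of the Kontsevich–Zagier calculus. Representations with
empty domain are relations and are discarded (replaced by the zero representation `[pt, 0]`); for
the remaining full domains the values are the numbers `rᵢ.integrand pt`, the vanishing of the
evaluation is the pointwise identity `0 = Σᵢ mᵢ · rᵢ.integrand` on `ℝ⁰`, and integer-weighted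
integrand additivity (rule 1b) merges the combination into the zero representation.
[cite: KontsevichZagier2001, §1.2] -/
theorem tateLifting_dimZeroSector :
    ∀ (s : ℕ) (m : Fin s → ℤ) (r : Fin s → KZ.IntegralRep 0),
      KZ.eval (∑ i, m i • KZ.of (r i)) = 0 → ∑ i, m i • KZ.of (r i) ∈ KZ.relations := by
  classical
  intro s m r hev
  obtain ⟨z, hzd, hzi⟩ := KZ.exists_zeroRep (n := 0) (σ := univ) isSemialgebraic_univ
  have hz : KZ.of z ∈ KZ.relations :=
    KZ.of_mem_relations_of_eqOn_zero z (by rw [hzi]; exact fun _ _ => rfl)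
  -- discard the empty domains
  have h1 := DimOne.dzs_sum_sub_sum_ite_mem m r z hz
  -- the modified combination has full domains and still evaluates to zero
  have hd : ∀ i, (if (default : Fin 0 → ℝ) ∈ (r i).domain then r i else z).domain = univ := by
    intro i
    by_cases h : (default : Fin 0 → ℝ) ∈ (r i).domain
    · rw [if_pos h]
      exact DimOne.dzs_domain_eq_univ (r i) h
    · rw [if_neg h]
      exact hzd
  have hev' : KZ.eval (∑ i, m i • KZ.of (if (default : Fin 0 → ℝ) ∈ (r i).domain then r i else z)) =
      0 := by
    have h := KZ.relations_le_ker_eval_holds h1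
    rwa [AddMonoidHom.mem_ker, map_sub, hev, zero_sub, neg_eq_zero] at h
  have h2 := DimOne.dzs_sum_zsmul_mem_of_domain_eq_univ m _ hd hev'
  have e : ∑ i, m i • KZ.of (r i) =
      (∑ i, m i • KZ.of (r i) -
          ∑ i, m i • KZ.of (if (default : Fin 0 → ℝ) ∈ (r i).domain then r i else z)) +
        ∑ i, m i • KZ.of (if (default : Fin 0 → ℝ) ∈ (r i).domain then r i else z) := by
    abel
  rw [e]
  exact KZ.relations.add_mem h1 h2

end Summit.KontsevichZagierPeriods.InverseLandau

end
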